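import Mathlib
import Summits.Ventures.PercRepro2.CoinKSureLayer
import Summits.Ventures.PercRepro2.CoinKSureAD
import Summits.Ventures.PercRepro2.CoinKSureFibers
import Summits.Ventures.PercRepro2.CoinChainScStates
import Summits.Ventures.PercRepro2.CoinChainScLevels

/-!
# The gate-only inequality (SC): the entered part of the gate functional against the ideal part
with the coefficient `G'(D)/G(D)` on the ideal term (blind cell PercRepro2, night-2 g24;
proofs/NIGHT2-DARC.md §64)

Abstract weights on `U.powerset` as in `gate_functional_nonneg`: `G` (the `R`-law) and `G'` (the
gate), log-supermodular, the gate Holley-above the `R`-law from every entered cluster (`wML`),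
equal to it on the entry-free ideal `I = {W ∩ ent = ∅}` (`hI`), `G' ≤ G`; nonnegative increasing
markers `x, y`; `Λ, Λ₁, Λ₂` the `R`-law totals, `D` the entered clusters.  With
`S_I = ∑_I G (Λx − Λ₁)(Λy − Λ₂)` and `S_D = ∑_D G' (Λx − Λ₁)(Λy − Λ₂)` the clean-state theorem
reads `S_I + S_D ≥ 0`; **(SC)** is `G(D) · S_D + G'(D) · S_I ≥ 0` (`sc_functional_nonneg`).  The
one extra hypothesis `hmod` is the MODIFIED STATE LOG-SUPERMODULARITY for two disjoint nonempty
entry states: `G(D) N(e) N(e') ≤ G'(D) N(∅) N(e ∪ e')` (`N(e)` the gate mass of the state `e`) —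
for the chain it follows from the log-supermodularity of the global gate law and the Holley
comparison of the ideal with the entered clusters (`CoinChainScChain`).

Proof: with `κ = G'(D)/G(D)` the modified state law `N'(∅) = κ N(∅)`, `N'(e) = N(e)` is
log-supermodular (`modified_state_lsm`) and the state means of the gate increase on its support
(`fiber_holley`), so `csl_main` applies to `∑_e N'(e)(ΛX̄_e − Λ₁)(ΛȲ_e − Λ₂)` (FKG:
`modified_state_fkg`; level sums: `level_sum_eq` + `level_holley`; base: `ideal_mean`); the
within-state FKG `fiber_cov` completes each state's term to its cluster sum.
-/

namespace Summit.Ventures.PercRepro2.Coin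

open Classical

section ScAbstract

variable {V : Type*} [DecidableEq V] {R : Type*} [Field R] [LinearOrder R] [IsStrictOrderedRing R]

/-- **(SC) — THE GATE-ONLY INEQUALITY.** `G(D) · S_D + G'(D) · S_I ≥ 0`. -/
theorem sc_functional_nonneg (U ent : Finset V) (G G' x y : Finset V → R)
    (hG : ∀ W, 0 ≤ G W) (hG' : ∀ W, 0 ≤ G' W) (hG'G : ∀ W, G' W ≤ G W)
    (hx0 : ∀ W, 0 ≤ x W) (hy0 : ∀ W, 0 ≤ y W)
    (hxm : ∀ s t, x s ≤ x (s ∪ t)) (hym : ∀ s t, y s ≤ y (s ∪ t))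
    (wLL : ∀ s ⊆ U, ∀ t ⊆ U, G s * G t ≤ G (s ∩ t) * G (s ∪ t))
    (wMM : ∀ s ⊆ U, ∀ t ⊆ U, G' s * G' t ≤ G' (s ∩ t) * G' (s ∪ t))
    (wML : ∀ s ⊆ U, ∀ t ⊆ U, (∃ r ∈ ent, r ∈ s) → G' s * G t ≤ G (s ∩ t) * G' (s ∪ t))
    (hI : ∀ W, W ∩ ent = ∅ → G' W = G W)
    (hmod : ∀ e ⊆ ent, ∀ e' ⊆ ent, e ∩ e' = ∅ → e ≠ ∅ → e' ≠ ∅ →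
      (∑ W ∈ U.powerset.filter (fun W => ¬ (W ∩ ent = ∅)), G W) *
          ((∑ W ∈ U.powerset.filter (fun W => W ∩ ent = e), G' W) *
            (∑ W ∈ U.powerset.filter (fun W => W ∩ ent = e'), G' W)) ≤
        (∑ W ∈ U.powerset.filter (fun W => ¬ (W ∩ ent = ∅)), G' W) *
          ((∑ W ∈ U.powerset.filter (fun W => W ∩ ent = ∅), G' W) *
            (∑ W ∈ U.powerset.filter (fun W => W ∩ ent = e ∪ e'), G' W))) :
    0 ≤ (∑ W ∈ U.powerset.filter (fun W => ¬ (W ∩ ent = ∅)), G W) *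
          (∑ W ∈ U.powerset.filter (fun W => ¬ (W ∩ ent = ∅)), G' W *
            (((∑ W ∈ U.powerset, G W) * x W - (∑ W ∈ U.powerset, G W * x W)) *
              ((∑ W ∈ U.powerset, G W) * y W - (∑ W ∈ U.powerset, G W * y W))))
        + (∑ W ∈ U.powerset.filter (fun W => ¬ (W ∩ ent = ∅)), G' W) *
          (∑ W ∈ U.powerset.filter (fun W => W ∩ ent = ∅), G W *
            (((∑ W ∈ U.powerset, G W) * x W - (∑ W ∈ U.powerset, G W * x W)) *
              ((∑ W ∈ U.powerset, G W) * y W - (∑ W ∈ U.powerset, G W * y W)))) := by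
  -- the `R`-law totals
  set Λ := ∑ W ∈ U.powerset, G W with hΛ
  set Λ₁ := ∑ W ∈ U.powerset, G W * x W with hΛ₁
  set Λ₂ := ∑ W ∈ U.powerset, G W * y W with hΛ₂
  have hΛ0 : 0 ≤ Λ := Finset.sum_nonneg fun W _ => hG W
  have hΛ₁0 : 0 ≤ Λ₁ := Finset.sum_nonneg fun W _ => mul_nonneg (hG W) (hx0 W)
  have hΛ₂0 : 0 ≤ Λ₂ := Finset.sum_nonneg fun W _ => mul_nonneg (hG W) (hy0 W)
  clear_value Λ Λ₁ Λ₂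
  -- state masses and moments of the gate
  set N : Finset V → R := fun e => ∑ W ∈ U.powerset.filter (fun W => W ∩ ent = e), G' W with hN
  set Nx : Finset V → R :=
    fun e => ∑ W ∈ U.powerset.filter (fun W => W ∩ ent = e), G' W * x W with hNx
  set Ny : Finset V → R :=
    fun e => ∑ W ∈ U.powerset.filter (fun W => W ∩ ent = e), G' W * y W with hNy
  set Nxy : Finset V → R :=
    fun e => ∑ W ∈ U.powerset.filter (fun W => W ∩ ent = e), G' W * (x W * y W) with hNxy
  have hN0 : ∀ e, 0 ≤ N e := fun e => Finset.sum_nonneg fun W _ => hG' W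
  have hNx0 : ∀ e, 0 ≤ Nx e := fun e => Finset.sum_nonneg fun W _ => mul_nonneg (hG' W) (hx0 W)
  have hNy0 : ∀ e, 0 ≤ Ny e := fun e => Finset.sum_nonneg fun W _ => mul_nonneg (hG' W) (hy0 W)
  -- the entered masses of the two laws
  set r := ∑ W ∈ U.powerset.filter (fun W => ¬ (W ∩ ent = ∅)), G W with hr
  set g := ∑ W ∈ U.powerset.filter (fun W => ¬ (W ∩ ent = ∅)), G' W with hg
  have hr0 : 0 ≤ r := Finset.sum_nonneg fun W _ => hG W
  have hg0 : 0 ≤ g := Finset.sum_nonneg fun W _ => hG' W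
  have hgr : g ≤ r := Finset.sum_le_sum fun W _ => hG'G W
  -- the entered and the ideal parts of the functional
  set SD := ∑ W ∈ U.powerset.filter (fun W => ¬ (W ∩ ent = ∅)), G' W *
    ((Λ * x W - Λ₁) * (Λ * y W - Λ₂)) with hSD
  set SI := ∑ W ∈ U.powerset.filter (fun W => W ∩ ent = ∅), G W *
    ((Λ * x W - Λ₁) * (Λ * y W - Λ₂)) with hSI
  show 0 ≤ r * SD + g * SI
  -- the ideal part with the gate weights (equal there)
  have hG'I : ∀ W ∈ U.powerset.filter (fun W => W ∩ ent = ∅), G' W = G W :=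
    fun W hW => hI W (Finset.mem_filter.mp hW).2
  have hSI' : SI = ∑ W ∈ U.powerset.filter (fun W => W ∩ ent = ∅), G' W *
      ((Λ * x W - Λ₁) * (Λ * y W - Λ₂)) :=
    Finset.sum_congr rfl fun W hW => by rw [hG'I W hW]
  -- the degenerate case: no entered mass at all
  rcases eq_or_lt_of_le hr0 with hrz | hrpos
  · have hgz : g = 0 := by
      have h1 : g ≤ 0 := by rw [← hrz] at hgr; exact hgr
      exact le_antisymm h1 hg0
    have hG'D : ∀ W ∈ U.powerset.filter (fun W => ¬ (W ∩ ent = ∅)), G' W = 0 :=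
      (Finset.sum_eq_zero_iff_of_nonneg (fun W _ => hG' W)).mp hgz
    have hSDz : SD = 0 := Finset.sum_eq_zero fun W hW => by rw [hG'D W hW, zero_mul]
    rw [← hrz, hgz, hSDz]; simp
  -- the modified state law
  set κ := g / r with hκ
  have hκ0 : 0 ≤ κ := div_nonneg hg0 hr0
  have hκr : κ * r = g := div_mul_cancel₀ g (ne_of_gt hrpos)
  set N' : Finset V → R := fun e => if e = ∅ then κ * N e else N e with hN'
  have hN'0 : ∀ e, 0 ≤ N' e := fun e => by
    simp only [hN']; split_ifs
    · exact mul_nonneg hκ0 (hN0 e)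
    · exact hN0 e
  have hN'ne : ∀ e, N' e ≠ 0 → N e ≠ 0 := by
    intro e h hz
    apply h
    simp only [hN']; rw [hz]; split_ifs <;> simp
  have hN'empty : N' ∅ = κ * N ∅ := by simp only [hN', if_true]
  have hN'of : ∀ e, e ≠ ∅ → N' e = N e := by
    intro e he; simp only [hN']; rw [if_neg he]
  -- the modified state law is log-supermodular on the state lattice
  have hN'lsm : ∀ e ⊆ ent, ∀ e' ⊆ ent, N' e * N' e' ≤ N' (e ∩ e') * N' (e ∪ e') :=
    modified_state_lsm ent N r g κ hrpos hκr (fun e he e' he' => fiber_lsm U ent e e' G' hG' wMM)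
      (fun e he e' he' h3 h1 h2 => hmod e he e' he' h3 h1 h2)
  -- the state means
  set Xs : Finset V → R := fun e => Nx e / N e with hXs
  set Ys : Finset V → R := fun e => Ny e / N e with hYs
  have hXs0 : ∀ e, 0 ≤ Xs e := fun e => div_nonneg (hNx0 _) (hN0 _)
  have hYs0 : ∀ e, 0 ≤ Ys e := fun e => div_nonneg (hNy0 _) (hN0 _)
  have hNXs : ∀ e, N e * Xs e = Nx e := by
    intro e
    by_cases h : N e = 0
    · have hx := fiber_zero U ent e G' x hG' h
      show N e * (Nx e / N e) = Nx e
      rw [h, zero_mul]; exact hx.symm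
    · show N e * (Nx e / N e) = Nx e
      field_simp
  have hNYs : ∀ e, N e * Ys e = Ny e := by
    intro e
    by_cases h : N e = 0
    · have hy := fiber_zero U ent e G' y hG' h
      show N e * (Ny e / N e) = Ny e
      rw [h, zero_mul]; exact hy.symm
    · show N e * (Ny e / N e) = Ny e
      field_simp
  -- the state means are increasing on the support
  have hXs_mono : ∀ e e', e ⊆ e' → N e ≠ 0 → N e' ≠ 0 → Xs e ≤ Xs e' := by
    intro e e' hee hNe hNe'
    have hpe : 0 < N e := lt_of_le_of_ne (hN0 e) (Ne.symm hNe)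
    have hpe' : 0 < N e' := lt_of_le_of_ne (hN0 e') (Ne.symm hNe')
    have key : Nx e * N e' ≤ N e * Nx e' := fiber_holley U ent e e' G' x hG' hx0 hxm wMM hee
    show Nx e / N e ≤ Nx e' / N e'
    rw [div_le_div_iff₀ hpe hpe']
    linarith [key]
  have hYs_mono : ∀ e e', e ⊆ e' → N e ≠ 0 → N e' ≠ 0 → Ys e ≤ Ys e' := by
    intro e e' hee hNe hNe'
    have hpe : 0 < N e := lt_of_le_of_ne (hN0 e) (Ne.symm hNe)
    have hpe' : 0 < N e' := lt_of_le_of_ne (hN0 e') (Ne.symm hNe')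
    have key : Ny e * N e' ≤ N e * Ny e' := fiber_holley U ent e e' G' y hG' hy0 hym wMM hee
    show Ny e / N e ≤ Ny e' / N e'
    rw [div_le_div_iff₀ hpe hpe']
    linarith [key]
  -- FKG on the state lattice for the modified law
  have hF : (∑ e ∈ ent.powerset, N' e * Xs e) * (∑ e ∈ ent.powerset, N' e * Ys e) ≤
      (∑ e ∈ ent.powerset, N' e) * (∑ e ∈ ent.powerset, N' e * (Xs e * Ys e)) :=
    modified_state_fkg ent N' Xs Ys hN'0 hXs0 hYs0 hN'lsm
      (fun e e' h h1 h2 => hXs_mono e e' h (hN'ne e h1) (hN'ne e' h2))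
      (fun e e' h h1 h2 => hYs_mono e e' h (hN'ne e h1) (hN'ne e' h2))
  -- the ideal state: its means are below the global `R`-means
  have hNI : N ∅ = ∑ W ∈ U.powerset.filter (fun W => W ∩ ent = ∅), G W :=
    Finset.sum_congr rfl fun W hW => hG'I W hW
  have hNxI : Nx ∅ = ∑ W ∈ U.powerset.filter (fun W => W ∩ ent = ∅), G W * x W :=
    Finset.sum_congr rfl fun W hW => by rw [hG'I W hW]
  have hNyI : Ny ∅ = ∑ W ∈ U.powerset.filter (fun W => W ∩ ent = ∅), G W * y W :=
    Finset.sum_congr rfl fun W hW => by rw [hG'I W hW]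
  have hu₀ : Λ * Xs ∅ - Λ₁ ≤ 0 := by
    by_cases h : N ∅ = 0
    · simp only [hXs]; rw [h, div_zero, mul_zero]
      linarith
    · have hpos : 0 < N ∅ := lt_of_le_of_ne (hN0 ∅) (Ne.symm h)
      have key : Nx ∅ * Λ ≤ N ∅ * Λ₁ := by
        rw [hNxI, hNI, hΛ, hΛ₁]; exact ideal_mean U ent G x hG hx0 hxm wLL
      have : Λ * Xs ∅ ≤ Λ₁ := by
        show Λ * (Nx ∅ / N ∅) ≤ Λ₁
        rw [mul_div_assoc', div_le_iff₀ hpos]; linarith [key]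
      linarith
  have hw₀ : Λ * Ys ∅ - Λ₂ ≤ 0 := by
    by_cases h : N ∅ = 0
    · simp only [hYs]; rw [h, div_zero, mul_zero]
      linarith
    · have hpos : 0 < N ∅ := lt_of_le_of_ne (hN0 ∅) (Ne.symm h)
      have key : Ny ∅ * Λ ≤ N ∅ * Λ₂ := by
        rw [hNyI, hNI, hΛ, hΛ₂]; exact ideal_mean U ent G y hG hy0 hym wLL
      have : Λ * Ys ∅ ≤ Λ₂ := by
        show Λ * (Ny ∅ / N ∅) ≤ Λ₂
        rw [mul_div_assoc', div_le_iff₀ hpos]; linarith [key]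
      linarith
  -- every state mean on the support is above the ideal state mean
  have hu : ∀ e ∈ ent.powerset, N' e ≠ 0 → Λ * Xs ∅ - Λ₁ ≤ Λ * Xs e - Λ₁ := by
    intro e _ he0
    have hle : Xs ∅ ≤ Xs e := by
      by_cases h : N ∅ = 0
      · simp only [hXs]; rw [h, div_zero]; exact hXs0 e
      · exact hXs_mono ∅ e (Finset.empty_subset _) h (hN'ne e he0)
    have := mul_le_mul_of_nonneg_left hle hΛ0
    linarith
  have hw : ∀ e ∈ ent.powerset, N' e ≠ 0 → Λ * Ys ∅ - Λ₂ ≤ Λ * Ys e - Λ₂ := by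
    intro e _ he0
    have hle : Ys ∅ ≤ Ys e := by
      by_cases h : N ∅ = 0
      · simp only [hYs]; rw [h, div_zero]; exact hYs0 e
      · exact hYs_mono ∅ e (Finset.empty_subset _) h (hN'ne e he0)
    have := mul_le_mul_of_nonneg_left hle hΛ0
    linarith
  -- joins of an entered cluster of the gate support with a cluster of the `R`-support
  have hjoin' : ∀ s ⊆ U, ∀ t ⊆ U, (∃ r ∈ ent, r ∈ s) → G' s ≠ 0 → G t ≠ 0 →
      G' (s ∪ t) ≠ 0 := by
    intro s hs t ht hent hs0 ht0 hu
    have h1 : 0 < G' s * G t :=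
      mul_pos (lt_of_le_of_ne (hG' s) (Ne.symm hs0)) (lt_of_le_of_ne (hG t) (Ne.symm ht0))
    have h2 := wML s hs t ht hent
    rw [hu, mul_zero] at h2
    exact absurd (lt_of_lt_of_le h1 h2) (lt_irrefl 0)
  have hNpos : ∀ s ⊆ U, G' s ≠ 0 → N (s ∩ ent) ≠ 0 := by
    intro s hs hs0 hz
    have h1 : 0 < G' s := lt_of_le_of_ne (hG' s) (Ne.symm hs0)
    have h2 : G' s ≤ N (s ∩ ent) :=
      Finset.single_le_sum (f := G') (fun W _ => hG' W)
        (Finset.mem_filter.mpr ⟨Finset.mem_powerset.mpr hs, rfl⟩)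
    rw [hz] at h2
    exact absurd (lt_of_lt_of_le h1 h2) (lt_irrefl 0)
  -- a level sum over the entered states is a cluster sum
  have hN'of' : ∀ e, e ≠ ∅ → N' e = ∑ W ∈ U.powerset.filter (fun W => W ∩ ent = e), G' W :=
    fun e he => hN'of e he
  have hlevelx : ∀ (w : Finset V → R) (t : R), (w ∅ < t) →
      (∑ e ∈ ent.powerset.filter (fun e => t ≤ w e), N' e * (Λ * Xs e - Λ₁)) =
        Λ * (∑ W ∈ U.powerset.filter (fun W => t ≤ w (W ∩ ent)), G' W * x W) -
          Λ₁ * (∑ W ∈ U.powerset.filter (fun W => t ≤ w (W ∩ ent)), G' W) :=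
    fun w t ht => level_sum_eq U ent G' x hG' N' w t Λ Λ₁ ht hN'of'
  have hlevely : ∀ (w : Finset V → R) (t : R), (w ∅ < t) →
      (∑ e ∈ ent.powerset.filter (fun e => t ≤ w e), N' e * (Λ * Ys e - Λ₂)) =
        Λ * (∑ W ∈ U.powerset.filter (fun W => t ≤ w (W ∩ ent)), G' W * y W) -
          Λ₂ * (∑ W ∈ U.powerset.filter (fun W => t ≤ w (W ∩ ent)), G' W) :=
    fun w t ht => level_sum_eq U ent G' y hG' N' w t Λ Λ₂ ht hN'of'
  -- the level sets of the `y`-shift: the gate on cluster-up-sets of entered clusters is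
  -- Holley-above the `R`-law
  have hlevw : ∀ t, Λ * Ys ∅ - Λ₂ < t →
      0 ≤ ∑ e ∈ ent.powerset.filter (fun e => t ≤ Λ * Ys e - Λ₂), N' e * (Λ * Xs e - Λ₁) := by
    intro t ht
    rw [hlevelx (fun e => Λ * Ys e - Λ₂) t ht]
    have hP : ∀ s ⊆ U, ∀ t' ⊆ U, t ≤ Λ * Ys (s ∩ ent) - Λ₂ → G' s ≠ 0 → G t' ≠ 0 →
        t ≤ Λ * Ys ((s ∪ t') ∩ ent) - Λ₂ ∧ (∃ r ∈ ent, r ∈ s) := by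
      intro s hs t' ht' hPs hs0 ht'0
      have hent : ∃ r ∈ ent, r ∈ s := by
        by_contra hno
        have hse : s ∩ ent = ∅ := by
          rw [Finset.eq_empty_iff_forall_notMem]
          intro r hr
          rw [Finset.mem_inter] at hr
          exact hno ⟨r, hr.2, hr.1⟩
        rw [hse] at hPs
        linarith
      refine ⟨?_, hent⟩
      have hu0 := hjoin' s hs t' ht' hent hs0 ht'0
      have hNs := hNpos s hs hs0
      have hNu := hNpos (s ∪ t') (Finset.union_subset hs ht') hu0
      have hee : s ∩ ent ⊆ (s ∪ t') ∩ ent :=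
        Finset.inter_subset_inter Finset.subset_union_left (Finset.Subset.refl _)
      have hmono := hYs_mono (s ∩ ent) ((s ∪ t') ∩ ent) hee hNs hNu
      have := mul_le_mul_of_nonneg_left hmono hΛ0
      linarith
    have key := level_holley U ent G G' x hG hG' hx0 hxm wML
      (fun W => t ≤ Λ * Ys (W ∩ ent) - Λ₂) hP
    rw [← hΛ, ← hΛ₁] at key
    linarith [key]
  -- the level sets of the `x`-shift
  have hlevu : ∀ t, Λ * Xs ∅ - Λ₁ < t →
      0 ≤ ∑ e ∈ ent.powerset.filter (fun e => t ≤ Λ * Xs e - Λ₁), N' e * (Λ * Ys e - Λ₂) := by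
    intro t ht
    rw [hlevely (fun e => Λ * Xs e - Λ₁) t ht]
    have hP : ∀ s ⊆ U, ∀ t' ⊆ U, t ≤ Λ * Xs (s ∩ ent) - Λ₁ → G' s ≠ 0 → G t' ≠ 0 →
        t ≤ Λ * Xs ((s ∪ t') ∩ ent) - Λ₁ ∧ (∃ r ∈ ent, r ∈ s) := by
      intro s hs t' ht' hPs hs0 ht'0
      have hent : ∃ r ∈ ent, r ∈ s := by
        by_contra hno
        have hse : s ∩ ent = ∅ := by
          rw [Finset.eq_empty_iff_forall_notMem]
          intro r hr
          rw [Finset.mem_inter] at hr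
          exact hno ⟨r, hr.2, hr.1⟩
        rw [hse] at hPs
        linarith
      refine ⟨?_, hent⟩
      have hu0 := hjoin' s hs t' ht' hent hs0 ht'0
      have hNs := hNpos s hs hs0
      have hNu := hNpos (s ∪ t') (Finset.union_subset hs ht') hu0
      have hee : s ∩ ent ⊆ (s ∪ t') ∩ ent :=
        Finset.inter_subset_inter Finset.subset_union_left (Finset.Subset.refl _)
      have hmono := hXs_mono (s ∩ ent) ((s ∪ t') ∩ ent) hee hNs hNu
      have := mul_le_mul_of_nonneg_left hmono hΛ0
      linarith
    have key := level_holley U ent G G' y hG hG' hy0 hym wML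
      (fun W => t ≤ Λ * Xs (W ∩ ent) - Λ₁) hP
    rw [← hΛ, ← hΛ₂] at key
    linarith [key]
  -- FKG on the state lattice in the centred form
  have e1 : (∑ e ∈ ent.powerset, N' e * (Λ * Xs e - Λ₁)) =
      Λ * (∑ e ∈ ent.powerset, N' e * Xs e) - Λ₁ * (∑ e ∈ ent.powerset, N' e) := by
    rw [Finset.mul_sum, Finset.mul_sum, ← Finset.sum_sub_distrib]
    exact Finset.sum_congr rfl fun e _ => by ring
  have e2 : (∑ e ∈ ent.powerset, N' e * (Λ * Ys e - Λ₂)) =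
      Λ * (∑ e ∈ ent.powerset, N' e * Ys e) - Λ₂ * (∑ e ∈ ent.powerset, N' e) := by
    rw [Finset.mul_sum, Finset.mul_sum, ← Finset.sum_sub_distrib]
    exact Finset.sum_congr rfl fun e _ => by ring
  have e3 : (∑ e ∈ ent.powerset, N' e * (Λ * Xs e - Λ₁) * (Λ * Ys e - Λ₂)) =
      Λ * Λ * (∑ e ∈ ent.powerset, N' e * (Xs e * Ys e))
        - Λ * Λ₂ * (∑ e ∈ ent.powerset, N' e * Xs e)
        - Λ * Λ₁ * (∑ e ∈ ent.powerset, N' e * Ys e)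
        + Λ₁ * Λ₂ * (∑ e ∈ ent.powerset, N' e) := by
    rw [Finset.mul_sum, Finset.mul_sum, Finset.mul_sum, Finset.mul_sum,
      ← Finset.sum_sub_distrib, ← Finset.sum_sub_distrib, ← Finset.sum_add_distrib]
    exact Finset.sum_congr rfl fun e _ => by ring
  have hfkg : (∑ e ∈ ent.powerset, N' e * (Λ * Xs e - Λ₁)) *
      (∑ e ∈ ent.powerset, N' e * (Λ * Ys e - Λ₂)) ≤
      (∑ e ∈ ent.powerset, N' e) *
        ∑ e ∈ ent.powerset, N' e * (Λ * Xs e - Λ₁) * (Λ * Ys e - Λ₂) := by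
    rw [e1, e2, e3]
    have key := mul_le_mul_of_nonneg_left hF (mul_nonneg hΛ0 hΛ0)
    linarith [key]
  -- the clean state lemma on the state lattice
  have hT2 : 0 ≤ ∑ e ∈ ent.powerset, N' e * (Λ * Xs e - Λ₁) * (Λ * Ys e - Λ₂) :=
    csl_main ent.powerset N' (fun e => Λ * Xs e - Λ₁) (fun e => Λ * Ys e - Λ₂)
      (fun e _ => hN'0 e) (Λ * Xs ∅ - Λ₁) (Λ * Ys ∅ - Λ₂) hu₀ hw₀ hu hw hfkg hlevw hlevu
  -- each state's term is dominated by its cluster sum (within-state FKG)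
  set T : Finset V → R := fun e => ∑ W ∈ U.powerset.filter (fun W => W ∩ ent = e),
    G' W * ((Λ * x W - Λ₁) * (Λ * y W - Λ₂)) with hT
  have hNxy0 : ∀ e, 0 ≤ Nxy e :=
    fun e => Finset.sum_nonneg fun W _ => mul_nonneg (hG' W) (mul_nonneg (hx0 W) (hy0 W))
  have hstate : ∀ e, N e * (Λ * Xs e - Λ₁) * (Λ * Ys e - Λ₂) ≤ T e := by
    intro e
    have hTe : T e = Λ * Λ * Nxy e - Λ * Λ₂ * Nx e - Λ * Λ₁ * Ny e + Λ₁ * Λ₂ * N e := by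
      show (∑ W ∈ U.powerset.filter (fun W => W ∩ ent = e),
        G' W * ((Λ * x W - Λ₁) * (Λ * y W - Λ₂))) = _
      rw [centred_expand_sc]
    have hcov : N e * (Xs e * Ys e) ≤ Nxy e := by
      by_cases h : N e = 0
      · rw [h, zero_mul]; exact hNxy0 e
      · have hpos : 0 < N e := lt_of_le_of_ne (hN0 e) (Ne.symm h)
        have key : Nx e * Ny e ≤ N e * Nxy e := fiber_cov U ent e G' x y hG' hx0 hy0 hxm hym wMM
        show N e * (Nx e / N e * (Ny e / N e)) ≤ Nxy e
        rw [div_mul_div_comm, mul_div_assoc', div_le_iff₀ (mul_pos hpos hpos)]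
        calc N e * (Nx e * Ny e) ≤ N e * (N e * Nxy e) := mul_le_mul_of_nonneg_left key hpos.le
          _ = Nxy e * (N e * N e) := by ring
    have e5 : N e * (Λ * Xs e - Λ₁) * (Λ * Ys e - Λ₂) =
        Λ * Λ * (N e * (Xs e * Ys e)) - Λ * Λ₂ * (N e * Xs e) - Λ * Λ₁ * (N e * Ys e)
          + Λ₁ * Λ₂ * N e := by ring
    rw [e5, hNXs e, hNYs e, hTe]
    have := mul_le_mul_of_nonneg_left hcov (mul_nonneg hΛ0 hΛ0)
    linarith
  -- the state sums against the cluster sums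
  have hsplitT : (∑ e ∈ ent.powerset, T e) = SI + SD := by
    have hmaps : ∀ W ∈ U.powerset, (fun W => W ∩ ent) W ∈ ent.powerset :=
      fun W _ => Finset.mem_powerset.mpr Finset.inter_subset_right
    have h1 : (∑ e ∈ ent.powerset, T e) = ∑ W ∈ U.powerset,
        G' W * ((Λ * x W - Λ₁) * (Λ * y W - Λ₂)) := by
      simp only [hT]
      exact Finset.sum_fiberwise_of_maps_to hmaps _
    rw [h1, hSI', hSD, ← Finset.sum_filter_add_sum_filter_not U.powerset (fun W => W ∩ ent = ∅)]
  have hTempty : T ∅ = SI := by rw [hSI']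
  have hmem : (∅ : Finset V) ∈ ent.powerset := Finset.mem_powerset.mpr (Finset.empty_subset _)
  have hsumN' : (∑ e ∈ ent.powerset, N' e * (Λ * Xs e - Λ₁) * (Λ * Ys e - Λ₂)) ≤ κ * SI + SD := by
    rw [← Finset.add_sum_erase ent.powerset _ hmem]
    have hrest : (∑ e ∈ ent.powerset.erase ∅, N' e * (Λ * Xs e - Λ₁) * (Λ * Ys e - Λ₂)) ≤
        ∑ e ∈ ent.powerset.erase ∅, T e := by
      refine Finset.sum_le_sum fun e he => ?_
      rw [hN'of e (Finset.ne_of_mem_erase he)]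
      exact hstate e
    have hrestT : (∑ e ∈ ent.powerset.erase ∅, T e) = SD := by
      have := Finset.add_sum_erase ent.powerset T hmem
      rw [hsplitT, hTempty] at this
      linarith
    have hempty : N' ∅ * (Λ * Xs ∅ - Λ₁) * (Λ * Ys ∅ - Λ₂) ≤ κ * SI := by
      rw [hN'empty, ← hTempty]
      have := mul_le_mul_of_nonneg_left (hstate ∅) hκ0
      calc κ * N ∅ * (Λ * Xs ∅ - Λ₁) * (Λ * Ys ∅ - Λ₂)
          = κ * (N ∅ * (Λ * Xs ∅ - Λ₁) * (Λ * Ys ∅ - Λ₂)) := by ring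
        _ ≤ κ * T ∅ := this
    linarith [hrest, hrestT, hempty]
  have hfinal : 0 ≤ r * (κ * SI + SD) := mul_nonneg hrpos.le (le_trans hT2 hsumN')
  calc (0 : R) ≤ r * (κ * SI + SD) := hfinal
    _ = r * SD + g * SI := by rw [← hκr]; ring

end ScAbstract

end Summit.Ventures.PercRepro2.Coin
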